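import Mathlib.AlgebraicGeometry.Pullbacks
import Mathlib.AlgebraicGeometry.Morphisms.Smooth
import Mathlib.AlgebraicGeometry.Morphisms.Proper
import Mathlib.Algebra.Category.ModuleCat.ChangeOfRings
import Literature.AlgebraicGeometry.Motives.Varieties
import Literature.AlgebraicGeometry.Motives.AlgPoints
import Literature.AlgebraicGeometry.Motives.HodgeStructure
import Literature.AlgebraicGeometry.Motives.BettiRealization
import Literature.AlgebraicGeometry.Motives.LocalSystems
import HarnessLib

-- D-0014 sorry-sweep (operator, 2026-08-13): sorried theorems -> named facts `def X : Prop`; partial proofs preserved in comments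
-- provenance: harness21/H21/H21/Prelude/MotiveL/FamiliesVHS.lean @ 50fe52b (interim HEAD d8f2665); M5 mechanical rewrite
/-!
# Families of varieties and (the topological + Hodge data of) variations of Hodge structure
(trunk MotiveL, prelude C13)

## Families
For a morphism `f : 𝒳 ⟶ S` of `k`-schemes and a `k`-rational point `s ∈ S(k)`, the **fibre**
`𝒳_s = 𝒳 ×_S Spec k` is `Literature.fiberOver f s : SchemeOver k` (Mathlib `Limits.pullback f.left s.left`
with structure map through `𝒳`), with its inclusion `Literature.fiberι f s : fiberOver f s ⟶ 𝒳` and its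
structure map `Literature.fiberOverToSpec f s : fiberOver f s ⟶ Spec k` (the second projection).
`Literature.IsSmoothProjectiveFamily f n` says that `f` is smooth of relative dimension `n` and proper and
that every fibre over a rational point is a smooth projective variety of dimension `n`
(Hartshorne III.10; Voisin, *Hodge Theory and Complex Algebraic Geometry I*, §9.1.1).

## Variations of Hodge structure
A polarized variation of `ℤ`-Hodge structure of weight `n` on a complex manifold `S`
(Griffiths, *Periods of integrals on algebraic manifolds I–III* (1968–70); Schmid, *Variation of
Hodge structure: the singularities of the period mapping*, Invent. Math. 22 (1973), §2;
Cattani–Deligne–Kaplan, *On the locus of Hodge classes*, JAMS 8 (1995), §1) consists of a local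
system `V_ℤ` of finitely generated free abelian groups, a flat bilinear form `Q` on `V_ℚ`, and a
holomorphically varying, Griffiths-transversal Hodge filtration on `V ⊗ 𝒪_S` inducing on every
fibre a Hodge structure of weight `n` polarized by `Q_s`.

`Literature.VHSData S n` records exactly the **topological and pointwise Hodge-theoretic part** of this:
the local systems `VZ`, `V` with `V ≅ VZ ⊗ ℚ`, a Hodge structure `hodge s` on each fibre `V_s`
together with a polarization `form s` (untwisted sign convention of
`Literature.AlgebraicGeometry.Motives.HodgeStructure.Polarization`, accepted G17/C5), flatness of the polarization form
(`transport_form`) and finiteness/freeness of `VZ_s`. **Holomorphy of the Hodge bundles `F^p` and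
Griffiths transversality `∇F^p ⊆ F^{p-1} ⊗ Ω¹_S` are NOT fields**: they need the analytification of
`S` and holomorphic vector bundles (trunk T-KAEHLER), which are not available here. Consequently
`VHSData` is a *hypothesis structure*: every statement made against it in H21 is a `Prop`-valued
definition whose docstring says "for `D` underlying an honest polarized VHS".

* `VHSData.toRat D s : VZ_s →+ V_s` (`u ↦ 1 ⊗ u` through `ratIso`; an `AddMonoidHom` rather
  than `→ₗ[ℤ]` to avoid the `ModuleCat ℤ` vs `AddCommGroup.toIntModule` instance mismatch),
  `VHSData.IsHodgeAt D s p u` (the integral vector `u ∈ VZ_s` is a Hodge class of level `p`, i.e.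
  `1 ⊗ u ∈ F^p`; for `n = 2p` this is "`u` is of type `(p, p)`"),
  `VHSData.hodgeLocusOfNormLe D p K ⊆ S` (the points carrying a nonzero integral Hodge class `u` with `Q(u, u) ≤ K`; CDK 1995, Thm. 1.1),
  `VHSData.form_monodromyRep` (monodromy preserves the polarization).
* `Literature.IsZariskiClosedOnPoints T A`: a set `A ⊆ T(L)` of `L`-points of a `k`-scheme is cut out by a
  Zariski-closed subset of `T` (used to phrase "the Hodge locus is algebraic", CDK 1995, Cor. 1.2).
* `Literature.GeometricVHSData B f n i`: `VHSData` on `S(ℂ)` of weight `i` coming from geometry, i.e. from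
  `Rⁱ f_* ℚ` for a smooth projective family `f : 𝒳 ⟶ S` over `ℂ`, relative to Betti–Hodge
  realization data `B : BettiHodgeData ℂ` (accepted C13 of MotiveAbstract): fibrewise
  identifications `V_s ≃ Hⁱ(𝒳_s)` carrying `hodge s` to `B.hodge`, and compatibility of parallel
  transport with restriction from `Hⁱ(𝒳)` (Voisin, *Hodge Theory II*, §3.1.1; Deligne, *Théorie de
  Hodge II*, 4.1.1). `GeometricVHSData.restrict D s : Hⁱ(𝒳) →ₗ V_s`,
  `transport_comp_restrict`, `restrict_mem_flatSections`.

## Mathlib search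
Mathlib HAS a scheme-theoretic fibre API: `AlgebraicGeometry.Scheme.Hom.fiber f y :=
pullback f (Y.fromSpecResidueField y)` with `Scheme.Hom.fiberι`,
`Scheme.Hom.fiberToSpecResidueField` and `Scheme.Hom.fiber_fac` (`Mathlib/AlgebraicGeometry/Fiber.lean`). We use a deliberate variant
`fiberOver f s` — the fibre over a `k`-*rational point* `s : AlgPoints S k`, i.e. the pullback along
`s.left : Spec k ⟶ S`, packaged as a `k`-scheme in `Over (Spec k)` — because the consumers
(`IsSmoothProjective n : SchemeOver k → Prop`, `B.W.obj : SchemeOver ℂ → _`) live on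
`SchemeOver k`; for a rational point `κ(s.pt) ≅ k` and `Scheme.Hom.fiber f.left s.pt` is
isomorphic to `(fiberOver f s).left` (comparison lemma left as debt). Mathlib has no local
systems, Hodge structures or variations thereof (searched `VariationHodge`, `HodgeStructure`,
`LocalSystem`: nothing). We use Mathlib's `Limits.pullback`, `Over.mk`/`Over.homMk`,
`AlgebraicGeometry.SmoothOfRelativeDimension`, `AlgebraicGeometry.IsProper`,
`ModuleCat.extendScalars` (through `LocalSystem.baseChange`) and the scoped `ChangeOfRings`
notation `s ⊗ₜ[R,f] m`.

## Design notes
* `fiberOver f s` has structure map `pullback.fst ≫ 𝒳.hom`, so that `fiberι` is an `Over`-morphism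
  by `rfl`; `fiberOver_hom` identifies it with `pullback.snd ≫ (specOver k k).hom`.
* `IsSmoothProjectiveFamily f n` asks for `SmoothOfRelativeDimension n f.left` (not merely
  `Smooth`), so that the relative dimension is enforced on all of `S`, including components without
  `k`-rational points.
* Rational points only (`s : AlgPoints S k`), as in the outline: for `k = ℂ` these are all complex
  points, which is what `GeometricVHSData` consumes.
* `GeometricVHSData.fiberIso` is a `LinearEquiv` (rather than a `ModuleCat` isomorphism), matching
  `BettiHodgeData.isoObj`; `hodge_F_eq` transports the Hodge filtration along its complexification.
* In `hodgeLocusOfNormLe` the integral class is required to be nonzero: with `u = 0` allowed the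
  locus would be all of `S` for `K ≥ 0` (vacuity smell). Since `Q_s` is positive definite on real
  `(p, p)`-classes in weight `2p`, this is the image in `S` of the positive-norm part of the CDK
  space `S^{(K)}`.
* The planned name `monodromy_mem_hodgeGroup` is deliberately absent ("-free" in the outline): the
  inclusion of (a finite-index subgroup of) monodromy in the Hodge group holds only at Hodge-generic
  points and needs `HodgeTensor`; the "free" consequence of the data, `form_monodromyRep`, is here.

## References
* P. Griffiths, *Periods of integrals on algebraic manifolds III*, Publ. Math. IHÉS 38 (1970), §1.
* W. Schmid, *Variation of Hodge structure: the singularities of the period mapping*, Invent.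
  Math. 22 (1973), §2.
* E. Cattani, P. Deligne, A. Kaplan, *On the locus of Hodge classes*, JAMS 8 (1995), Thm. 1.1,
  Cor. 1.2.
* C. Voisin, *Hodge Theory and Complex Algebraic Geometry I*, §9.1–§10.2; *II*, §3.1, §5.3.
* P. Deligne, *Théorie de Hodge II*, Publ. Math. IHÉS 40 (1971), §4.1.
* R. Hartshorne, *Algebraic Geometry*, II.3 (fibres), III.10 (smooth families).
-/

universe u

open CategoryTheory AlgebraicGeometry Limits
open scoped TensorProduct ChangeOfRings

noncomputable section

namespace Literature.AlgebraicGeometry.Motives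

/-! ### Fibres of families -/

section Families

variable {k : Type u} [Field k] {𝒳 S : SchemeOver k}

/-- The **fibre** `𝒳_s = 𝒳 ×_S Spec k` of a morphism of `k`-schemes `f : 𝒳 ⟶ S` over a
`k`-rational point `s ∈ S(k)`, as a `k`-scheme (Mathlib `Limits.pullback f.left s.left`, with
structure map `𝒳_s → 𝒳 → Spec k`; Hartshorne, *Algebraic Geometry*, II.3, p. 89 "fibre of a
morphism"). Compare Mathlib's `Scheme.Hom.fiber f.left s.pt` (pullback along
`Spec κ(s.pt) ⟶ S`), which is isomorphic since `s` is rational; this variant is used because it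
is a `SchemeOver k`, as required by `IsSmoothProjective` and Weil cohomology theories. [folklore] -/
def fiberOver (f : 𝒳 ⟶ S) (s : AlgPoints S k) : SchemeOver k :=
  Over.mk (pullback.fst f.left s.left ≫ 𝒳.hom)

/-- The underlying scheme of `fiberOver f s` is the fibre product `𝒳 ×_S Spec k` (by `rfl`;
Hartshorne II.3). [folklore] -/
@[simp]
theorem fiberOver_left (f : 𝒳 ⟶ S) (s : AlgPoints S k) :
    (fiberOver f s).left = pullback f.left s.left := rfl

/-- The closed-fibre inclusion `𝒳_s ⟶ 𝒳` over `k` (first projection of the fibre product;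
Hartshorne II.3). [folklore] -/
def fiberι (f : 𝒳 ⟶ S) (s : AlgPoints S k) : fiberOver f s ⟶ 𝒳 :=
  Over.homMk (pullback.fst f.left s.left) rfl

/-- The underlying scheme morphism of `fiberι f s` is `pullback.fst` (by `rfl`; Hartshorne II.3). [folklore] -/
@[simp]
theorem fiberι_left (f : 𝒳 ⟶ S) (s : AlgPoints S k) :
    (fiberι f s).left = pullback.fst f.left s.left := rfl

/-- The structure map of the fibre is the second projection to `Spec k` followed by the
structure map of `Spec k` (commutativity of the pullback square; Hartshorne II.3). [folklore] -/
theorem fiberOver_hom (f : 𝒳 ⟶ S) (s : AlgPoints S k) :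
    (fiberOver f s).hom = pullback.snd f.left s.left ≫ (specOver k k).hom := by
  change pullback.fst f.left s.left ≫ 𝒳.hom = _
  rw [← Over.w f, ← Category.assoc, pullback.condition, Category.assoc, Over.w s]

/-- The structure morphism `𝒳_s ⟶ Spec k` of the fibre as a morphism of `k`-schemes (second
projection of the fibre product; Hartshorne II.3). [folklore] -/
def fiberOverToSpec (f : 𝒳 ⟶ S) (s : AlgPoints S k) : fiberOver f s ⟶ specOver k k :=
  Over.homMk (pullback.snd f.left s.left) (fiberOver_hom f s).symm

/-- The fibre square commutes in `Over (Spec k)`: `𝒳_s ⟶ 𝒳 ⟶ S` equals `𝒳_s ⟶ Spec k ⟶ S`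
(Hartshorne II.3). [folklore] -/
theorem fiberι_comp (f : 𝒳 ⟶ S) (s : AlgPoints S k) :
    fiberι f s ≫ f = fiberOverToSpec f s ≫ s := by
  ext : 1
  exact pullback.condition

/-- `f : 𝒳 ⟶ S` is a **smooth projective family of relative dimension `n`** over `k`: `f` is
smooth of relative dimension `n` and proper, and every fibre over a `k`-rational point is a smooth
projective (geometrically integral) variety of dimension `n` (Hartshorne III.10; Voisin, *Hodge
Theory I*, §9.1.1; Deligne, *Théorie de Hodge II*, 4.1.1). Uses Mathlib
`AlgebraicGeometry.SmoothOfRelativeDimension` and `AlgebraicGeometry.IsProper`. [folklore] -/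
structure IsSmoothProjectiveFamily (f : 𝒳 ⟶ S) (n : ℕ) : Prop where
  /-- `f` is smooth of relative dimension `n`. -/
  smoothOfRelativeDimension : SmoothOfRelativeDimension n f.left
  /-- `f` is proper. -/
  isProper : IsProper f.left
  /-- Every rational fibre is a smooth projective variety of dimension `n`. -/
  isSmoothProjective : ∀ s : AlgPoints S k, IsSmoothProjective n (fiberOver f s)

/-- A smooth projective family is a smooth morphism (Mathlib
`SmoothOfRelativeDimension.smooth`; Hartshorne III.10). [folklore] -/
theorem IsSmoothProjectiveFamily.smooth {f : 𝒳 ⟶ S} {n : ℕ} (hf : IsSmoothProjectiveFamily f n) :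
    AlgebraicGeometry.Smooth f.left :=
  haveI := hf.smoothOfRelativeDimension
  SmoothOfRelativeDimension.smooth n f.left

end Families

/-! ### Zariski-closed sets of points -/

section Zariski

variable {k : Type u} [Field k] {L : Type u} [Field L] [Algebra k L]

/-- A set `A ⊆ T(L)` of `L`-points of a `k`-scheme `T` **is Zariski closed on points** if it is
the set of `L`-points whose underlying scheme point lies in some closed subset `Z ⊆ T`, i.e.
`A = Z(L)` (used for "the Hodge locus is algebraic": Cattani–Deligne–Kaplan 1995, Cor. 1.2). [cite: CattaniDeligneKaplan1995, Cor. 1.2] -/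
def IsZariskiClosedOnPoints (T : SchemeOver k) (A : Set (AlgPoints T L)) : Prop :=
  ∃ Z : Set T.left, IsClosed Z ∧ A = {P | P.pt ∈ Z}

/-- The whole set of points is Zariski closed on points (`Z = T`). [folklore] -/
theorem isZariskiClosedOnPoints_univ (T : SchemeOver k) :
    IsZariskiClosedOnPoints T (Set.univ : Set (AlgPoints T L)) :=
  ⟨Set.univ, isClosed_univ, by simp⟩

/-- The empty set of points is Zariski closed on points (`Z = ∅`). [folklore] -/
theorem isZariskiClosedOnPoints_empty (T : SchemeOver k) :
    IsZariskiClosedOnPoints T (∅ : Set (AlgPoints T L)) :=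
  ⟨∅, isClosed_empty, by simp⟩

/-- Sets Zariski closed on points are stable under binary intersection. [folklore] -/
theorem IsZariskiClosedOnPoints.inter {T : SchemeOver k} {A B : Set (AlgPoints T L)}
    (hA : IsZariskiClosedOnPoints T A) (hB : IsZariskiClosedOnPoints T B) :
    IsZariskiClosedOnPoints T (A ∩ B) := by
  obtain ⟨Z, hZ, rfl⟩ := hA
  obtain ⟨Z', hZ', rfl⟩ := hB
  exact ⟨Z ∩ Z', hZ.inter hZ', by ext; simp⟩

/-- Sets Zariski closed on points are stable under binary union. [folklore] -/
theorem IsZariskiClosedOnPoints.union {T : SchemeOver k} {A B : Set (AlgPoints T L)}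
    (hA : IsZariskiClosedOnPoints T A) (hB : IsZariskiClosedOnPoints T B) :
    IsZariskiClosedOnPoints T (A ∪ B) := by
  obtain ⟨Z, hZ, rfl⟩ := hA
  obtain ⟨Z', hZ', rfl⟩ := hB
  exact ⟨Z ∪ Z', hZ.union hZ', by ext; simp⟩

end Zariski

/-! ### The data of a polarized variation of Hodge structure -/

/-- The **topological and pointwise Hodge data of a polarized variation of `ℤ`-Hodge structure**
of weight `n` on a topological space `S` (Griffiths 1970, §1; Schmid 1973, §2; Cattani–Deligne–
Kaplan 1995, §1): a local system `VZ` of finitely generated free abelian groups, a local system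
`V` of `ℚ`-vector spaces with `V ≅ VZ ⊗ ℚ`, on each fibre `V_s` a Hodge structure of weight `n`
with a polarization `Q_s` (untwisted convention of `HodgeStructure.Polarization`), the forms
`Q_s` being flat (invariant under parallel transport).

**Not recorded** (no analytification available): holomorphy of the Hodge bundles `F^p ⊆ V ⊗ 𝒪_S`
and Griffiths transversality. This is therefore a hypothesis structure; statements against it
are `Prop`-valued definitions "for `D` underlying an honest polarized VHS". [cite: Griffiths1970, §1] -/
structure VHSData (S : Type) [TopologicalSpace S] (n : ℤ) where
  /-- The integral local system `V_ℤ`. -/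
  VZ : LocalSystem ℤ S
  /-- The rational local system `V = V_ℚ`. -/
  V : LocalSystem ℚ S
  /-- The identification `V ≅ V_ℤ ⊗ ℚ` of local systems (the integral structure is flat). -/
  ratIso : V ≅ VZ.baseChange (Int.castRingHom ℚ)
  /-- The Hodge structure of weight `n` on the fibre `V_s`. -/
  hodge (s : S) : HodgeStructure (V.fiber s) n
  /-- The polarization `Q_s` of the Hodge structure on `V_s`. -/
  form (s : S) : (hodge s).Polarization
  /-- The polarization forms are flat: `Q_t(γ_* x, γ_* y) = Q_s(x, y)` for every homotopy class
  of paths `γ` from `s` to `t`. -/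
  transport_form : ∀ (s t : S) (γ : Path.Homotopic.Quotient s t) (x y : V.fiber s),
    (form t).form (V.transport γ x) (V.transport γ y) = (form s).form x y
  /-- Each integral fibre `V_ℤ,s` is a finitely generated free abelian group. -/
  finite_free : ∀ s : S, Module.Finite ℤ (VZ.fiber s) ∧ Module.Free ℤ (VZ.fiber s)

namespace VHSData

variable {S : Type} [TopologicalSpace S] {n : ℤ} (D : VHSData S n)

/-- The integral fibres of a VHS datum are finitely generated (Schmid 1973, §2). [cite: Schmid1973, §2] -/
theorem finite (s : S) : Module.Finite ℤ (D.VZ.fiber s) := (D.finite_free s).1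

/-- The integral fibres of a VHS datum are free (Schmid 1973, §2). [cite: Schmid1973, §2] -/
theorem free (s : S) : Module.Free ℤ (D.VZ.fiber s) := (D.finite_free s).2

/-- The element `1 ⊗ u ∈ V_ℤ,s ⊗ ℚ` attached to an integral vector `u ∈ V_ℤ,s` (Mathlib
`ModuleCat.extendScalars`, scoped notation `⊗ₜ[ℤ,f]`). [folklore] -/
def oneTmul (s : S) (u : D.VZ.fiber s) : (D.VZ.baseChange (Int.castRingHom ℚ)).fiber s :=
  (1 : ℚ) ⊗ₜ[ℤ,Int.castRingHom ℚ] u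

/-- `oneTmul` is additive. [folklore] -/
theorem oneTmul_add (s : S) (u v : D.VZ.fiber s) :
    D.oneTmul s (u + v) = D.oneTmul s u + D.oneTmul s v :=
  TensorProduct.tmul_add _ _ _

/-- The comparison map `V_ℤ,s → V_s`, `u ↦ ratIso⁻¹ (1 ⊗ u)`, from the integral to the rational
fibre (Schmid 1973, §2: `V_ℚ = V_ℤ ⊗ ℚ`), as an additive monoid homomorphism. [cite: Schmid1973, §2:  V_ℚ = V_ℤ ⊗ ℚ] -/
def toRat (s : S) : D.VZ.fiber s →+ D.V.fiber s :=
  AddMonoidHom.mk' (fun u => (D.ratIso.inv.app ⟨s⟩).hom (D.oneTmul s u))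
    fun u v => by rw [oneTmul_add, map_add]

/-- `toRat` unfolded: `toRat u = ratIso⁻¹ (1 ⊗ u)`. [folklore] -/
theorem toRat_apply (s : S) (u : D.VZ.fiber s) :
    D.toRat s u = (D.ratIso.inv.app ⟨s⟩).hom (D.oneTmul s u) := rfl

/-- `toRat` is compatible with parallel transport (naturality of `ratIso`; the integral structure
is a sub-local system: Schmid 1973, §2). [cite: Schmid1973, §2] -/
theorem transport_toRat {s t : S} (γ : Path.Homotopic.Quotient s t) (u : D.VZ.fiber s) :
    D.V.transport γ (D.toRat s u) = D.toRat t (D.VZ.transport γ u) := by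
  have h := congrArg (fun φ => φ.hom (D.oneTmul s u))
    (D.ratIso.inv.naturality (FundamentalGroupoid.fromPath γ))
  simp only [ModuleCat.hom_comp, LinearMap.comp_apply] at h
  rw [toRat_apply, toRat_apply, LocalSystem.transport, ← h]
  rfl

/-- `toRat` is injective (`V_ℤ,s` is free, hence flat, over `ℤ`, so `V_ℤ,s → V_ℤ,s ⊗ ℚ` is
injective; Schmid 1973, §2). [cite: Schmid1973, §2] -/
def toRat_injective : Prop :=
  ∀ (s : S),
    Function.Injective (D.toRat s)

/-- The integral vector `u ∈ V_ℤ,s` **is a Hodge class of level `p`** at `s`: its image in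
`V_s` lies in `V_s ∩ F^p`, i.e. in `(D.hodge s).hodgeClasses p`. For `n = 2p` this says that
`u` is of Hodge type `(p, p)` (Cattani–Deligne–Kaplan 1995, §1; Voisin, *Hodge Theory II*,
§5.3.1). Meaningful for `D` underlying an honest polarized VHS. [cite: CattaniDeligneKaplan1995, §1] -/
def IsHodgeAt (s : S) (p : ℤ) (u : D.VZ.fiber s) : Prop :=
  D.toRat s u ∈ (D.hodge s).hodgeClasses p

/-- `0` is a Hodge class. [folklore] -/
theorem isHodgeAt_zero (s : S) (p : ℤ) : D.IsHodgeAt s p 0 := by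
  simp only [IsHodgeAt, map_zero]
  exact Submodule.zero_mem _

/-- Hodge classes of level `p` at `s` form an additive subgroup of `V_ℤ,s` (the preimage of the
`ℚ`-subspace `hodgeClasses p`). [folklore] -/
theorem IsHodgeAt.add {s : S} {p : ℤ} {u v : D.VZ.fiber s} (hu : D.IsHodgeAt s p u)
    (hv : D.IsHodgeAt s p v) : D.IsHodgeAt s p (u + v) := by
  simp only [IsHodgeAt, map_add]
  exact Submodule.add_mem _ hu hv

/-- In weight `n = 2p`, an integral Hodge class of level `p` maps into the Hodge piece
`V^{p,p}` (it is real and lies in `F^p`; Voisin II, §5.3.1). [folklore] -/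
theorem IsHodgeAt.ofRat_mem_piece {s : S} {p : ℤ} (hn : p + p = n) {u : D.VZ.fiber s}
    (hu : D.IsHodgeAt s p u) :
    HodgeStructure.ofRat (D.toRat s u) ∈ (D.hodge s).piece p p :=
  (D.hodge s).ofRat_mem_piece_of_mem_hodgeClasses hn hu

/-- The **Hodge locus of self-intersection at most `K`** in level `p`: the set of `s ∈ S`
carrying a *nonzero* integral Hodge class `u ∈ V_ℤ,s` of level `p` with `Q_s(u, u) ≤ K`. This is
the image in `S` of the positive part of the space `S^{(K)} = {(s, u) | u ∈ V_ℤ,s Hodge,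
Q(u, u) ≤ K}` of Cattani–Deligne–Kaplan, *On the locus of Hodge classes* (1995), Thm. 1.1; `u ≠ 0`
avoids the zero section, which would make the locus all of `S`. Meaningful (in weight `n = 2p`)
for `D` underlying an honest polarized VHS. [folklore] -/
def hodgeLocusOfNormLe (p : ℤ) (K : ℤ) : Set S :=
  {s | ∃ u : D.VZ.fiber s, u ≠ 0 ∧ D.IsHodgeAt s p u ∧
    (D.form s).form (D.toRat s u) (D.toRat s u) ≤ (K : ℚ)}

/-- Membership in the Hodge locus, unfolded. [folklore] -/
theorem mem_hodgeLocusOfNormLe_iff (p K : ℤ) (s : S) :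
    s ∈ D.hodgeLocusOfNormLe p K ↔ ∃ u : D.VZ.fiber s, u ≠ 0 ∧ D.IsHodgeAt s p u ∧
      (D.form s).form (D.toRat s u) (D.toRat s u) ≤ (K : ℚ) :=
  Iff.rfl

/-- The Hodge loci increase with the bound `K`. [folklore] -/
theorem hodgeLocusOfNormLe_mono (p : ℤ) {K K' : ℤ} (h : K ≤ K') :
    D.hodgeLocusOfNormLe p K ⊆ D.hodgeLocusOfNormLe p K' := by
  rintro s ⟨u, hu0, hu, hK⟩
  exact ⟨u, hu0, hu, hK.trans (by exact_mod_cast h)⟩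

/-- **Monodromy preserves the polarization**: for every loop `γ` at `s`,
`Q_s(ρ(γ) x, ρ(γ) y) = Q_s(x, y)`, i.e. the monodromy representation lands in the orthogonal /
symplectic group of `Q_s` (Griffiths 1970, §1; Schmid 1973, §2). Immediate from
`transport_form`. [cite: Griffiths1970, §1] -/
theorem form_monodromyRep (s : S) (γ : FundamentalGroup S s) (x y : D.V.fiber s) :
    (D.form s).form (D.V.monodromyRep s γ x) (D.V.monodromyRep s γ y) = (D.form s).form x y := by
  rw [LocalSystem.monodromyRep_apply]
  exact D.transport_form s s _ x y

/-- Parallel transport carries integral Hodge classes at `s` with self-intersection `≤ K` to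
integral classes at `t` with the same self-intersection (flatness of `Q` and of `V_ℤ`); in
particular the fibrewise finiteness underlying CDK is uniform along paths. Stated as: the
transported class has the same norm (Schmid 1973, §2). [cite: Schmid1973, §2] -/
theorem form_transport_toRat {s t : S} (γ : Path.Homotopic.Quotient s t) (u : D.VZ.fiber s) :
    (D.form t).form (D.toRat t (D.VZ.transport γ u)) (D.toRat t (D.VZ.transport γ u)) =
      (D.form s).form (D.toRat s u) (D.toRat s u) := by
  rw [← transport_toRat, D.transport_form]

end VHSData

/-! ### Geometric variations: `Rⁱ f_* ℚ` of a smooth projective family -/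

/-- **Geometric VHS data**: the VHS datum on `S(ℂ)` of weight `i` underlying `Rⁱ f_* ℤ` for a
smooth projective family `f : 𝒳 ⟶ S` of relative dimension `n` over `ℂ`, relative to Betti–Hodge
realization data `B` (Griffiths 1970, §1; Deligne, *Théorie de Hodge II*, 4.1.1; Voisin, *Hodge
Theory II*, §3.1.1): a `VHSData (ComplexPoints S) i` together with identifications
`V_s ≃ Hⁱ(𝒳_s)` (in `B.W`, hence with `Hⁱ(𝒳_s(ℂ); ℚ)` via `B.iso`) under which `hodge s` is the
Hodge structure `B.hodge` of the smooth projective fibre `𝒳_s`, and such that restriction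
`Hⁱ(𝒳) → Hⁱ(𝒳_s) ≃ V_s` followed by parallel transport to `t` is restriction to `𝒳_t` (global
classes give flat sections). A hypothesis structure standing in for the construction of the
Gauss–Manin local system and Griffiths' theorem. [cite: Griffiths1970, §1] -/
structure GeometricVHSData (B : BettiHodgeData ℂ) {𝒳 S : SchemeOver ℂ} (f : 𝒳 ⟶ S) (n i : ℕ)
    extends VHSData (ComplexPoints S) (i : ℤ) where
  /-- `f` is a smooth projective family of relative dimension `n`. -/
  isSmoothProjectiveFamily : IsSmoothProjectiveFamily f n
  /-- The identification `V_s ≃ Hⁱ(𝒳_s)` of the rational fibre with the cohomology of the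
  fibre. -/
  fiberIso (s : ComplexPoints S) : V.fiber s ≃ₗ[ℚ] B.W.obj (fiberOver f s) i
  /-- Under `fiberIso s`, the Hodge filtration of `hodge s` is that of `B.hodge` on `Hⁱ(𝒳_s)`. -/
  hodge_F_eq : ∀ (s : ComplexPoints S) (p : ℤ), (hodge s).F p =
    ((B.hodge (isSmoothProjectiveFamily.isSmoothProjective s) i).F p).comap
      ((fiberIso s).toLinearMap.baseChange ℂ)
  /-- Restriction `Hⁱ(𝒳) → Hⁱ(𝒳_s) ≃ V_s` followed by parallel transport along any path from
  `s` to `t` is restriction to `𝒳_t`. -/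
  transport_restrict : ∀ (s t : ComplexPoints S) (γ : Path.Homotopic.Quotient s t),
    V.transport γ ∘ₗ ((fiberIso s).symm.toLinearMap ∘ₗ B.W.pullback (fiberι f s) i) =
      (fiberIso t).symm.toLinearMap ∘ₗ B.W.pullback (fiberι f t) i

namespace GeometricVHSData

variable {B : BettiHodgeData ℂ} {𝒳 S : SchemeOver ℂ} {f : 𝒳 ⟶ S} {n i : ℕ}
  (D : GeometricVHSData B f n i)

/-- Every fibre `𝒳_s` of the family underlying a geometric VHS datum is smooth projective of
dimension `n`. [folklore] -/
theorem isSmoothProjective_fiberOver (D : GeometricVHSData B f n i) (s : ComplexPoints S) :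
    IsSmoothProjective n (fiberOver f s) :=
  D.isSmoothProjectiveFamily.isSmoothProjective s

/-- The **restriction map** `Hⁱ(𝒳) →ₗ V_s`: pull-back to the fibre `𝒳_s` followed by
`(fiberIso s)⁻¹` (Deligne, Hodge II, 4.1.1; Voisin II, §3.1.1). [folklore] -/
def restrict (s : ComplexPoints S) : B.W.obj 𝒳 i →ₗ[ℚ] D.V.fiber s :=
  (D.fiberIso s).symm.toLinearMap ∘ₗ B.W.pullback (fiberι f s) i

/-- `restrict` unfolded. [folklore] -/
theorem restrict_apply (s : ComplexPoints S) (x : B.W.obj 𝒳 i) :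
    D.restrict s x = (D.fiberIso s).symm (B.W.pullback (fiberι f s) i x) := rfl

/-- Parallel transport of a restricted global class is the restricted class:
`γ_* (x|_{𝒳_s}) = x|_{𝒳_t}` (Deligne, Hodge II, 4.1.1). [folklore] -/
theorem transport_comp_restrict {s t : ComplexPoints S} (γ : Path.Homotopic.Quotient s t) :
    D.V.transport γ ∘ₗ D.restrict s = D.restrict t :=
  D.transport_restrict s t γ

/-- Pointwise form of `transport_comp_restrict`. [folklore] -/
theorem transport_restrict_apply {s t : ComplexPoints S} (γ : Path.Homotopic.Quotient s t)
    (x : B.W.obj 𝒳 i) : D.V.transport γ (D.restrict s x) = D.restrict t x :=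
  LinearMap.congr_fun (D.transport_comp_restrict γ) x

/-- Restrictions of a global class `x ∈ Hⁱ(𝒳)` to the fibres form a **flat section** of `V`
(the easy half of the theorem of the fixed part; Deligne, Hodge II, 4.1.1). [folklore] -/
theorem restrict_mem_flatSections (x : B.W.obj 𝒳 i) :
    (fun s => D.restrict s x) ∈ D.V.flatSections :=
  fun _ _ γ => D.transport_restrict_apply γ x

/-- In particular the restrictions of a global class are **monodromy invariant**
(Deligne, Hodge II, 4.1.1). [folklore] -/
theorem monodromyRep_restrict (s : ComplexPoints S) (γ : FundamentalGroup (ComplexPoints S) s)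
    (x : B.W.obj 𝒳 i) : D.V.monodromyRep s γ (D.restrict s x) = D.restrict s x := by
  rw [LocalSystem.monodromyRep_apply]
  exact D.transport_restrict_apply _ x

/-- Under `fiberIso s`, integral Hodge classes of level `p` at `s` are Hodge classes of
`Hⁱ(𝒳_s)` in the sense of `B` (transport of structure along `hodge_F_eq`). [folklore] -/
theorem isHodgeAt_iff (s : ComplexPoints S) (p : ℤ) (u : D.VZ.fiber s) :
    D.IsHodgeAt s p u ↔ D.fiberIso s (D.toRat s u) ∈
      (B.hodge (D.isSmoothProjective_fiberOver s) i).hodgeClasses p := by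
  simp only [VHSData.IsHodgeAt, HodgeStructure.mem_hodgeClasses_iff, D.hodge_F_eq,
    Submodule.mem_comap]
  constructor <;> intro h <;> simpa [HodgeStructure.ofRat] using h

end GeometricVHSData

end Literature.AlgebraicGeometry.Motives

end
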